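import Summits.AtomisticToContinuum.BoseEinsteinCondensation.Theses.BECZeroCrossingDilute
import Literature.MathematicalPhysics.QuantumLattice.SpinChargeKinematics
import Literature.MathematicalPhysics.QuantumLattice.LiebMattisSectorPF
import Literature.MathematicalPhysics.QuantumLattice.SpinChainsAkltCorrelationProofs
import Mathlib.Algebra.Order.Chebyshev
import Mathlib.Analysis.InnerProductSpace.PiL2
import HarnessLib

/-!
# Comparison of the all-pairs and nearest-neighbour interchange Dirichlet forms on `(ℤ/Lℤ)³`
# (stub `stub_interchangeComparison`, line `birth`, crux `NearIsotropicDiluteBEC` = stmt-AtomisticToContinuum-13905,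
# route BECZeroCrossingDilute, sub-problem BoseEinsteinCondensation)

**Statement.** For spin `½` on the torus `Λ = TorusSite 3 L = (ℤ/Lℤ)³` (`2 ≤ L`), a vector `ψ` and
the transposition `T_xy = permOp (Equiv.swap x y)` of the spins at `x, y`, put
`q(x,y) = Re⟨ψ, (1 - T_xy)ψ⟩`. Then `Σ_x Σ_y q(x,y) ≤ C·L⁵·Σ_{x ∼ y} q(x,y)` (ordered pairs on both
sides, `∼` the torus adjacency) with an absolute constant (`C = 144` here).

**Proof (canonical paths, Diaconis–Saloff-Coste).** (1) `q(x,y) = ½ S(x,y)` with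
`S(x,y) = Σ_σ ‖ψ(σ) - ψ(σ ∘ swap x y)‖²` (`nidB2_re_quad_eq`), so `n = √S` is an `ℓ²` norm of the
vector `(1 - T_xy)ψ`. (2) Quasi-triangle inequality `n(a,c) ≤ 2 n(a,b) + n(b,c)`
(`nidB2_quasi_triangle`): `swap a c = swap a b ∘ swap b c ∘ swap a b`, the telescoping
`1 - ABA = (1 - A) + A(1 - B) + AB(1 - A)` and the isometry of permutation operators. (3) Hence along
any chain `n(v₀,v_k) ≤ 2 Σ n(v_i,v_{i+1})` (`nidB2_chain`); joining `x` to `x + d` by the three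
coordinate legs of the torus and Cauchy–Schwarz gives the pointwise bound
`S(x,x+d) ≤ 48 L · (sum of S over the edges of the three full coordinate circles through the legs)`
(`nidB2_pointwise`). (4) Summing over `x` (translation invariance of the counting) and `d` gives
`Σ_{x,z} S(x,z) ≤ 48 L⁵ Σ_u Σ_i S(u, u + e_i) ≤ 144 L⁵ Σ_{u ∼ y} S(u,y)` (`nidB2_sum_bound`).

**Sources.** P. Diaconis, L. Saloff-Coste, *Comparison theorems for reversible Markov chains*,
Ann. Appl. Probab. **3** (1993) 696–730, §3 (canonical paths; interchange process). All statements
are finite-dimensional linear algebra and counting. [folklore]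
-/

noncomputable section

namespace Summit.AtomisticToContinuum.BoseEinsteinCondensation.Cruxes.NearIsotropicDiluteBEC.Birth

open scoped BigOperators Matrix ComplexOrder
open Literature.MathematicalPhysics.QuantumLattice Literature.Probability.LatticeModels Matrix Complex Finset

/-! ### The interchange Dirichlet form as an `ℓ²` norm -/

section Generic

variable {Λ : Type*} [Fintype Λ] [DecidableEq Λ] {q : ℕ}

/-- Re-indexing a sum over configurations by `σ ↦ σ ∘ e` for a site relabelling `e`. [folklore] -/
theorem nidB2_sum_comp_perm (e : Λ ≃ Λ) (f : TensorIndex Λ q → ℝ) :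
    ∑ σ : TensorIndex Λ q, f (fun x => σ (e x)) = ∑ σ, f σ := by
  simpa only [configPerm_apply] using Equiv.sum_comp (configPerm (q := q) e) f

/-- The interchange Dirichlet form of a permutation operator is half a squared `ℓ²` norm:
`Re⟨ψ, (1 - P_e)ψ⟩ = ½ Σ_σ ‖ψ(σ) - ψ(σ ∘ e)‖²` (uses only that `σ ↦ σ ∘ e` is a bijection).
Diaconis–Saloff-Coste (1993) §3. [folklore] -/
theorem nidB2_re_quad_eq (e : Λ ≃ Λ) (ψ : TensorIndex Λ q → ℂ) :
    (star ψ ⬝ᵥ ((1 : Op Λ q) - permOp e) *ᵥ ψ).re =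
      1 / 2 * ∑ σ : TensorIndex Λ q, ‖ψ σ - ψ (fun x => σ (e x))‖ ^ 2 := by
  have hsum : ∑ σ : TensorIndex Λ q, ‖ψ (fun x => σ (e x))‖ ^ 2 = ∑ σ, ‖ψ σ‖ ^ 2 :=
    nidB2_sum_comp_perm e (fun σ => ‖ψ σ‖ ^ 2)
  have hpt : ∀ a b : ℂ, ‖a - b‖ ^ 2 = ‖a‖ ^ 2 + ‖b‖ ^ 2 - 2 * (star a * b).re := by
    intro a b
    simp only [← Complex.normSq_eq_norm_sq, Complex.normSq_apply, Complex.sub_re, Complex.sub_im,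
      Complex.mul_re, Complex.star_def, Complex.conj_re, Complex.conj_im]
    ring
  have hre : ∀ a b : ℂ, (star a * (a - b)).re = ‖a‖ ^ 2 - (star a * b).re := by
    intro a b
    simp only [← Complex.normSq_eq_norm_sq, Complex.normSq_apply, Complex.sub_re, Complex.sub_im,
      Complex.mul_re, Complex.star_def, Complex.conj_re, Complex.conj_im]
    ring
  rw [sub_mulVec, one_mulVec, permOp_mulVec, dotProduct, Complex.re_sum]
  simp only [Pi.star_apply, Pi.sub_apply, hre, hpt]
  rw [Finset.sum_sub_distrib, Finset.sum_sub_distrib, Finset.sum_add_distrib, hsum, ← Finset.mul_sum]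
  ring

/-- Triangle inequality for the `ℓ²` norm `v ↦ √(Σ_i ‖v i‖²)` on `ι → ℂ`. [folklore] -/
theorem nidB2_l2_add_le {ι : Type*} [Fintype ι] (v w : ι → ℂ) :
    √(∑ i, ‖v i + w i‖ ^ 2) ≤ √(∑ i, ‖v i‖ ^ 2) + √(∑ i, ‖w i‖ ^ 2) := by
  have h := norm_add_le (WithLp.toLp 2 v : EuclideanSpace ℂ ι) (WithLp.toLp 2 w)
  rw [← WithLp.toLp_add] at h
  simpa only [EuclideanSpace.norm_eq, PiLp.toLp_apply, Pi.add_apply] using h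

/-- `‖(1 - T_aa)ψ‖ = 0`: the transposition `swap a a` is the identity. [folklore] -/
theorem nidB2_l2_swap_self (ψ : TensorIndex Λ q → ℂ) (a : Λ) :
    √(∑ σ : TensorIndex Λ q, ‖ψ σ - ψ (fun x => σ (Equiv.swap a a x))‖ ^ 2) = 0 := by
  have h : ∀ σ : TensorIndex Λ q, ψ σ - ψ (fun x => σ (Equiv.swap a a x)) = 0 := fun σ => by
    rw [Equiv.swap_self]; exact sub_self _
  simp only [h, norm_zero]
  simp

/-- **Quasi-triangle inequality** for the interchange norms `n(a,b) = ‖(1 - T_ab)ψ‖`: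
`n(a,c) ≤ 2 n(a,b) + n(b,c)`. For distinct sites `swap a c = swap a b ∘ swap b c ∘ swap a b`, and
`1 - ABA = (1 - A) + A(1 - B) + AB(1 - A)` with `A`, `AB` isometries. Diaconis–Saloff-Coste (1993)
§3 (comparison of the interchange chain with its nearest-neighbour version). [folklore] -/
theorem nidB2_quasi_triangle (ψ : TensorIndex Λ q → ℂ) (a b c : Λ) :
    √(∑ σ : TensorIndex Λ q, ‖ψ σ - ψ (fun x => σ (Equiv.swap a c x))‖ ^ 2) ≤
      2 * √(∑ σ : TensorIndex Λ q, ‖ψ σ - ψ (fun x => σ (Equiv.swap a b x))‖ ^ 2) +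
        √(∑ σ : TensorIndex Λ q, ‖ψ σ - ψ (fun x => σ (Equiv.swap b c x))‖ ^ 2) := by
  classical
  rcases eq_or_ne c a with rfl | hca
  · rw [nidB2_l2_swap_self]; positivity
  rcases eq_or_ne c b with rfl | hcb
  · rw [nidB2_l2_swap_self, add_zero]
    linarith [Real.sqrt_nonneg (∑ σ : TensorIndex Λ q, ‖ψ σ - ψ (fun x => σ (Equiv.swap a c x))‖ ^ 2)]
  set A := Equiv.swap a b with hA
  set B := Equiv.swap b c with hB
  have hperm : Equiv.swap a c = A * B * A := by
    rw [hA, hB, Equiv.swap_comm a b, Equiv.swap_comm b c]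
    exact (Equiv.swap_mul_swap_mul_swap hcb hca).symm
  have hpt : ∀ σ : TensorIndex Λ q, ψ σ - ψ (fun x => σ (Equiv.swap a c x)) =
      ((ψ σ - ψ (fun x => σ (A x))) + (ψ (fun x => σ (A x)) - ψ (fun x => σ (A (B x))))) +
        (ψ (fun x => σ (A (B x))) - ψ (fun x => σ (A (B (A x))))) := by
    intro σ
    have hf : (fun x => σ (Equiv.swap a c x)) = fun x => σ (A (B (A x))) := by
      funext x; rw [hperm, Equiv.Perm.mul_apply, Equiv.Perm.mul_apply]
    rw [hf]; ring
  have h2 : √(∑ σ : TensorIndex Λ q, ‖ψ (fun x => σ (A x)) - ψ (fun x => σ (A (B x)))‖ ^ 2) =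
      √(∑ σ : TensorIndex Λ q, ‖ψ σ - ψ (fun x => σ (B x))‖ ^ 2) := by
    rw [nidB2_sum_comp_perm A (fun σ => ‖ψ σ - ψ (fun x => σ (B x))‖ ^ 2)]
  have h3 : √(∑ σ : TensorIndex Λ q, ‖ψ (fun x => σ (A (B x))) - ψ (fun x => σ (A (B (A x))))‖ ^ 2) =
      √(∑ σ : TensorIndex Λ q, ‖ψ σ - ψ (fun x => σ (A x))‖ ^ 2) := by
    rw [← nidB2_sum_comp_perm (A * B) (fun σ => ‖ψ σ - ψ (fun x => σ (A x))‖ ^ 2)]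
    simp only [Equiv.Perm.mul_apply]
  calc √(∑ σ : TensorIndex Λ q, ‖ψ σ - ψ (fun x => σ (Equiv.swap a c x))‖ ^ 2)
      = √(∑ σ : TensorIndex Λ q, ‖((ψ σ - ψ (fun x => σ (A x))) +
            (ψ (fun x => σ (A x)) - ψ (fun x => σ (A (B x))))) +
            (ψ (fun x => σ (A (B x))) - ψ (fun x => σ (A (B (A x)))))‖ ^ 2) := by
        simp only [hpt]
    _ ≤ √(∑ σ : TensorIndex Λ q, ‖(ψ σ - ψ (fun x => σ (A x))) +
            (ψ (fun x => σ (A x)) - ψ (fun x => σ (A (B x))))‖ ^ 2) +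
          √(∑ σ : TensorIndex Λ q, ‖ψ (fun x => σ (A (B x))) - ψ (fun x => σ (A (B (A x))))‖ ^ 2) :=
        nidB2_l2_add_le (fun σ => (ψ σ - ψ (fun x => σ (A x))) +
            (ψ (fun x => σ (A x)) - ψ (fun x => σ (A (B x)))))
          (fun σ => ψ (fun x => σ (A (B x))) - ψ (fun x => σ (A (B (A x)))))
    _ ≤ √(∑ σ : TensorIndex Λ q, ‖ψ σ - ψ (fun x => σ (A x))‖ ^ 2) +
          √(∑ σ : TensorIndex Λ q, ‖ψ (fun x => σ (A x)) - ψ (fun x => σ (A (B x)))‖ ^ 2) +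
          √(∑ σ : TensorIndex Λ q, ‖ψ (fun x => σ (A (B x))) - ψ (fun x => σ (A (B (A x))))‖ ^ 2) :=
        add_le_add (nidB2_l2_add_le (fun σ => ψ σ - ψ (fun x => σ (A x)))
          (fun σ => ψ (fun x => σ (A x)) - ψ (fun x => σ (A (B x))))) le_rfl
    _ = _ := by rw [h2, h3]; ring

/-- Mirror form of the quasi-triangle inequality: `n(a,c) ≤ n(a,b) + 2 n(b,c)` (from
`nidB2_quasi_triangle` and the symmetry `swap x y = swap y x`). [folklore] -/
theorem nidB2_quasi_triangle' (ψ : TensorIndex Λ q → ℂ) (a b c : Λ) :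
    √(∑ σ : TensorIndex Λ q, ‖ψ σ - ψ (fun x => σ (Equiv.swap a c x))‖ ^ 2) ≤
      √(∑ σ : TensorIndex Λ q, ‖ψ σ - ψ (fun x => σ (Equiv.swap a b x))‖ ^ 2) +
        2 * √(∑ σ : TensorIndex Λ q, ‖ψ σ - ψ (fun x => σ (Equiv.swap b c x))‖ ^ 2) := by
  classical
  have h := nidB2_quasi_triangle ψ c b a
  rw [Equiv.swap_comm c a, Equiv.swap_comm c b, Equiv.swap_comm b a] at h
  linarith

end Generic

/-! ### Quasi-metrics on the torus: chains, coordinate legs, counting -/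

/-- Chain bound for a quasi-metric: if `n(a,a) = 0` and `n(a,c) ≤ n(a,b) + 2 n(b,c)` then
`n(v₀,v_k) ≤ 2 Σ_{i<k} n(v_i,v_{i+1})`. [folklore] -/
theorem nidB2_chain {α : Type*} (n : α → α → ℝ) (hdiag : ∀ a, n a a = 0)
    (htri : ∀ a b c, n a c ≤ n a b + 2 * n b c) (v : ℕ → α) (k : ℕ) :
    n (v 0) (v k) ≤ 2 * ∑ i ∈ Finset.range k, n (v i) (v (i + 1)) := by
  induction k with
  | zero => simp [hdiag]
  | succ k ih =>
    rw [Finset.sum_range_succ, mul_add]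
    linarith [htri (v 0) (v k) (v (k + 1))]

/-- Translation invariance of sums over a finite additive group: `Σ_x G(x + c) = Σ_x G(x)`.
[folklore] -/
theorem nidB2_sum_add_right {α : Type*} [Fintype α] [AddGroup α] (G : α → ℝ) (c : α) :
    ∑ x, G (x + c) = ∑ x, G x :=
  Fintype.sum_equiv (Equiv.addRight c) _ _ (fun _ => rfl)

/-- Translation invariance of sums over a finite additive group: `Σ_x G(c + x) = Σ_x G(x)`.
[folklore] -/
theorem nidB2_sum_add_left {α : Type*} [Fintype α] [AddGroup α] (G : α → ℝ) (c : α) :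
    ∑ x, G (c + x) = ∑ x, G x :=
  Fintype.sum_equiv (Equiv.addLeft c) _ _ (fun _ => rfl)

/-- A coordinate leg on the torus: for a quasi-metric `n`, the distance from `p` to `p + t e_i` is
at most twice the sum of the `L` nearest-neighbour distances along the whole coordinate circle
through `p` in direction `i` (walk `p, p + e_i, …, p + t e_i` and enlarge the sum). [folklore] -/
theorem nidB2_leg {L : ℕ} [NeZero L] (n : TorusSite 3 L → TorusSite 3 L → ℝ)
    (h0 : ∀ a b, 0 ≤ n a b) (hdiag : ∀ a, n a a = 0) (htri : ∀ a b c, n a c ≤ n a b + 2 * n b c)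
    (p : TorusSite 3 L) (i : Fin 3) (t : ZMod L) :
    n p (p + Pi.single i t) ≤ 2 * ∑ j ∈ Finset.range L,
      n (p + Pi.single i ((j : ℕ) : ZMod L)) (p + Pi.single i ((j : ℕ) : ZMod L) + Pi.single i 1) := by
  have h := nidB2_chain n hdiag htri (fun j : ℕ => p + Pi.single i ((j : ℕ) : ZMod L)) t.val
  have e0 : p + Pi.single i (((0 : ℕ) : ℕ) : ZMod L) = p := by simp
  have et : p + Pi.single i (((t.val : ℕ) : ℕ) : ZMod L) = p + Pi.single i t := by
    rw [ZMod.natCast_zmod_val]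
  have es : ∀ j : ℕ, p + Pi.single i (((j + 1 : ℕ) : ℕ) : ZMod L) =
      p + Pi.single i ((j : ℕ) : ZMod L) + Pi.single i 1 := by
    intro j; rw [Nat.cast_succ, Pi.single_add, add_assoc]
  simp only [e0, et, es] at h
  refine h.trans (mul_le_mul_of_nonneg_left ?_ (by norm_num))
  exact Finset.sum_le_sum_of_subset_of_nonneg (Finset.range_mono (ZMod.val_lt t).le)
    fun _ _ _ => h0 _ _

/-- The arithmetic of the three-leg bound: `v ≤ 4(T₀ + T₁ + T₂)` and `T_i² ≤ L Q_i` give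
`v² ≤ 48 L (Q₀ + Q₁ + Q₂)` (since `(T₀ + T₁ + T₂)² ≤ 3 (T₀² + T₁² + T₂²)`). [folklore] -/
theorem nidB2_arith {v T₀ T₁ T₂ Q₀ Q₁ Q₂ M : ℝ} (hv : 0 ≤ v) (hn : v ≤ 4 * (T₀ + T₁ + T₂))
    (c0 : T₀ ^ 2 ≤ M * Q₀) (c1 : T₁ ^ 2 ≤ M * Q₁) (c2 : T₂ ^ 2 ≤ M * Q₂) :
    v ^ 2 ≤ 48 * M * (Q₀ + Q₁ + Q₂) := by
  have hx2 := pow_le_pow_left₀ hv hn 2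
  nlinarith [sq_nonneg (T₀ - T₁), sq_nonneg (T₀ - T₂), sq_nonneg (T₁ - T₂)]

/-- Cauchy–Schwarz on `range L`: `(Σ_{j<L} f j)² ≤ L Σ_{j<L} (f j)²`. [folklore] -/
theorem nidB2_cs (L : ℕ) (f : ℕ → ℝ) :
    (∑ j ∈ Finset.range L, f j) ^ 2 ≤ L * ∑ j ∈ Finset.range L, f j ^ 2 := by
  simpa only [Finset.card_range] using sq_sum_le_card_mul_sum_sq (s := Finset.range L) (f := f)

/-- **Pointwise canonical-path bound** on the torus `(ℤ/Lℤ)³` for a quasi-metric `n`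
(`n ≥ 0`, `n(a,a) = 0`, `n(a,c) ≤ 2n(a,b) + n(b,c)`, `n(a,c) ≤ n(a,b) + 2n(b,c)`): joining `x` to
`x + d` by the three coordinate legs `x → p₁ = x + d₀e₀ → p₂ = p₁ + d₁e₁ → x + d = p₂ + d₂e₂` and
using Cauchy–Schwarz over the `3L` edges of the three coordinate circles through `x`, `p₁`, `p₂`,
`n(x,x+d)² ≤ 48 L · Σ_{legs} Σ_{j<L} n(p + j e_i, p + j e_i + e_i)²`. Diaconis–Saloff-Coste (1993)
§3. [folklore] -/
theorem nidB2_pointwise {L : ℕ} [NeZero L] (n : TorusSite 3 L → TorusSite 3 L → ℝ)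
    (h0 : ∀ a b, 0 ≤ n a b) (hdiag : ∀ a, n a a = 0) (htri : ∀ a b c, n a c ≤ 2 * n a b + n b c)
    (htri' : ∀ a b c, n a c ≤ n a b + 2 * n b c) (x d p₁ p₂ : TorusSite 3 L)
    (hp₁ : x + Pi.single 0 (d 0) = p₁) (hp₂ : p₁ + Pi.single 1 (d 1) = p₂)
    (hp₃ : p₂ + Pi.single 2 (d 2) = x + d) :
    n x (x + d) ^ 2 ≤ 48 * L *
      ((∑ j ∈ Finset.range L, n (x + Pi.single 0 ((j : ℕ) : ZMod L))
          (x + Pi.single 0 ((j : ℕ) : ZMod L) + Pi.single 0 1) ^ 2) +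
       (∑ j ∈ Finset.range L, n (p₁ + Pi.single 1 ((j : ℕ) : ZMod L))
          (p₁ + Pi.single 1 ((j : ℕ) : ZMod L) + Pi.single 1 1) ^ 2) +
       (∑ j ∈ Finset.range L, n (p₂ + Pi.single 2 ((j : ℕ) : ZMod L))
          (p₂ + Pi.single 2 ((j : ℕ) : ZMod L) + Pi.single 2 1) ^ 2)) := by
  have l0 := nidB2_leg n h0 hdiag htri' x 0 (d 0)
  have l1 := nidB2_leg n h0 hdiag htri' p₁ 1 (d 1)
  have l2 := nidB2_leg n h0 hdiag htri' p₂ 2 (d 2)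
  rw [hp₁] at l0
  rw [hp₂] at l1
  rw [hp₃] at l2
  refine nidB2_arith (h0 _ _) ?_ (nidB2_cs L _) (nidB2_cs L _) (nidB2_cs L _)
  linarith [htri x p₁ (x + d), htri p₁ p₂ (x + d), h0 p₂ (x + d)]

/-- Each coordinate neighbour `u + e_i` of `u` is adjacent to `u` in the torus graph (`2 ≤ L`, so
`e_i ≠ 0`); hence for `Q ≥ 0`, `Σ_i Q(u, u + e_i) ≤ 3 Σ_{y ∼ u} Q(u, y)` (each term is one term of
the right-hand sum). [folklore] -/
theorem nidB2_adj {L : ℕ} [NeZero L] (hL : 2 ≤ L) (Q : TorusSite 3 L → TorusSite 3 L → ℝ)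
    (hQ : ∀ a b, 0 ≤ Q a b) (u : TorusSite 3 L) :
    ∑ i : Fin 3, Q u (u + Pi.single i 1) ≤
      3 * ∑ y, if (torusGraph 3 L).Adj u y then Q u y else 0 := by
  haveI : Fact (1 < L) := ⟨hL⟩
  have hadj : ∀ i : Fin 3, (torusGraph 3 L).Adj u (u + Pi.single i 1) := by
    intro i
    rw [torusGraph_adj_iff]
    refine ⟨fun h => ?_, Or.inl ⟨i, rfl⟩⟩
    have h1 := congrFun h i
    simp at h1
  have hle : ∀ i : Fin 3, Q u (u + Pi.single i 1) ≤
      ∑ y, if (torusGraph 3 L).Adj u y then Q u y else 0 := by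
    intro i
    have h := Finset.single_le_sum (s := Finset.univ)
      (f := fun y => if (torusGraph 3 L).Adj u y then Q u y else 0)
      (fun y _ => by
        show 0 ≤ (if (torusGraph 3 L).Adj u y then Q u y else 0)
        split_ifs
        · exact hQ _ _
        · exact le_rfl)
      (Finset.mem_univ (u + Pi.single i 1))
    simp only [if_pos (hadj i)] at h
    exact h
  calc ∑ i : Fin 3, Q u (u + Pi.single i 1)
      ≤ ∑ _i : Fin 3, ∑ y, (if (torusGraph 3 L).Adj u y then Q u y else 0) :=
        Finset.sum_le_sum fun i _ => hle i
    _ = 3 * ∑ y, (if (torusGraph 3 L).Adj u y then Q u y else 0) := by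
        rw [Finset.sum_const, Finset.card_univ, Fintype.card_fin]; norm_num

/-- **Comparison of Dirichlet forms for a quasi-metric on the torus** `(ℤ/Lℤ)³`, `2 ≤ L`:
`Σ_x Σ_z n(x,z)² ≤ 144 L⁵ Σ_{x ∼ y} n(x,y)²`. Sum the pointwise bound `nidB2_pointwise` over `x`
(the circle sums are translation invariant: each contributes `L Σ_u n(u,u+e_i)²`) and over the
`L³` values of `d`, then use `nidB2_adj`. Diaconis–Saloff-Coste (1993) §3. [folklore] -/
theorem nidB2_sum_bound {L : ℕ} [NeZero L] (hL : 2 ≤ L) (n : TorusSite 3 L → TorusSite 3 L → ℝ)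
    (h0 : ∀ a b, 0 ≤ n a b) (hdiag : ∀ a, n a a = 0) (htri : ∀ a b c, n a c ≤ 2 * n a b + n b c)
    (htri' : ∀ a b c, n a c ≤ n a b + 2 * n b c) :
    ∑ x, ∑ z, n x z ^ 2 ≤
      144 * (L : ℝ) ^ 5 * ∑ x, ∑ y, if (torusGraph 3 L).Adj x y then n x y ^ 2 else 0 := by
  have hB : ∀ (i : Fin 3) (c : TorusSite 3 L),
      ∑ x : TorusSite 3 L, ∑ j ∈ Finset.range L, n (x + c + Pi.single i ((j : ℕ) : ZMod L))
        (x + c + Pi.single i ((j : ℕ) : ZMod L) + Pi.single i 1) ^ 2 =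
        L * ∑ u : TorusSite 3 L, n u (u + Pi.single i 1) ^ 2 := by
    intro i c
    rw [Finset.sum_comm]
    have h : ∀ j ∈ Finset.range L, ∑ x : TorusSite 3 L, n (x + c + Pi.single i ((j : ℕ) : ZMod L))
        (x + c + Pi.single i ((j : ℕ) : ZMod L) + Pi.single i 1) ^ 2 =
        ∑ u : TorusSite 3 L, n u (u + Pi.single i 1) ^ 2 := by
      intro j _
      have h1 := nidB2_sum_add_right (fun u : TorusSite 3 L => n u (u + Pi.single i 1) ^ 2)
        (c + Pi.single i ((j : ℕ) : ZMod L))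
      simpa only [add_assoc] using h1
    rw [Finset.sum_congr rfl h, Finset.sum_const, Finset.card_range, nsmul_eq_mul]
  have hB0 := hB 0 0
  simp only [add_zero] at hB0
  have hA : ∀ d : TorusSite 3 L, ∑ x, n x (x + d) ^ 2 ≤
      48 * L * (L * ∑ u : TorusSite 3 L, ∑ i : Fin 3, n u (u + Pi.single i 1) ^ 2) := by
    intro d
    have hd : (Pi.single 0 (d 0) : TorusSite 3 L) + Pi.single 1 (d 1) + Pi.single 2 (d 2) = d := by
      rw [← Fin.sum_univ_three (fun i => (Pi.single i (d i) : TorusSite 3 L)),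
        Finset.univ_sum_single]
    refine (Finset.sum_le_sum fun x _ => nidB2_pointwise n h0 hdiag htri htri' x d
      (x + Pi.single 0 (d 0)) (x + (Pi.single 0 (d 0) + Pi.single 1 (d 1))) rfl (add_assoc _ _ _)
      (by rw [add_assoc, hd])).trans ?_
    rw [← Finset.mul_sum, Finset.sum_add_distrib, Finset.sum_add_distrib, hB0, hB 1, hB 2,
      ← mul_add, ← mul_add]
    refine le_of_eq ?_
    congr 2
    rw [Finset.sum_comm]
    simp only [Fin.sum_univ_three]
  have hV : (Fintype.card (TorusSite 3 L) : ℝ) = (L : ℝ) ^ 3 := by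
    have : Fintype.card (TorusSite 3 L) = L ^ 3 := by
      show Fintype.card (Fin 3 → ZMod L) = L ^ 3
      rw [Fintype.card_fun, ZMod.card, Fintype.card_fin]
    rw [this, Nat.cast_pow]
  have hΓ : ∑ u : TorusSite 3 L, ∑ i : Fin 3, n u (u + Pi.single i 1) ^ 2 ≤
      3 * ∑ x, ∑ y, if (torusGraph 3 L).Adj x y then n x y ^ 2 else 0 := by
    rw [Finset.mul_sum]
    exact Finset.sum_le_sum fun u _ => nidB2_adj hL (fun a b => n a b ^ 2) (fun a b => sq_nonneg _) u
  calc ∑ x, ∑ z, n x z ^ 2 = ∑ x : TorusSite 3 L, ∑ d : TorusSite 3 L, n x (x + d) ^ 2 :=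
        Finset.sum_congr rfl fun x _ => (nidB2_sum_add_left (fun z => n x z ^ 2) x).symm
    _ = ∑ d : TorusSite 3 L, ∑ x : TorusSite 3 L, n x (x + d) ^ 2 := Finset.sum_comm
    _ ≤ ∑ _d : TorusSite 3 L,
          48 * L * (L * ∑ u : TorusSite 3 L, ∑ i : Fin 3, n u (u + Pi.single i 1) ^ 2) :=
        Finset.sum_le_sum fun d _ => hA d
    _ = (L : ℝ) ^ 3 *
          (48 * L * (L * ∑ u : TorusSite 3 L, ∑ i : Fin 3, n u (u + Pi.single i 1) ^ 2)) := by
        rw [Finset.sum_const, Finset.card_univ, nsmul_eq_mul, hV]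
    _ ≤ (L : ℝ) ^ 3 *
          (48 * L * (L * (3 * ∑ x, ∑ y, if (torusGraph 3 L).Adj x y then n x y ^ 2 else 0))) := by
        gcongr
    _ = 144 * (L : ℝ) ^ 5 * ∑ x, ∑ y, if (torusGraph 3 L).Adj x y then n x y ^ 2 else 0 := by
        ring

/-! ### The registered stub -/

/-- **Interchange comparison** (stub `stub_interchangeComparison` of line `birth`, crux
`NearIsotropicDiluteBEC`): on the torus `(ℤ/Lℤ)³` (`2 ≤ L`), for every vector `ψ` of the
spin-`½` system, the all-pairs interchange Dirichlet form is controlled by the nearest-neighbour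
one, `Σ_x Σ_y Re⟨ψ,(1 - T_xy)ψ⟩ ≤ C L⁵ Σ_{x ∼ y} Re⟨ψ,(1 - T_xy)ψ⟩` with `T_xy = permOp (swap x y)`
and `C = 144` (ordered pairs on both sides). Proof: `Re⟨ψ,(1 - T_xy)ψ⟩ = ½‖(1 - T_xy)ψ‖²`
(`nidB2_re_quad_eq`); the norms form a quasi-metric (`nidB2_quasi_triangle`, from
`swap a c = swap a b ∘ swap b c ∘ swap a b`), and `nidB2_sum_bound` is the canonical-path
(coordinate-walk) comparison on the torus. Diaconis–Saloff-Coste, Ann. Appl. Probab. 3 (1993)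
696–730, §3. [folklore] -/
theorem stub_interchangeComparison :
    ∃ C : ℝ, 0 < C ∧ ∀ (L : ℕ) [NeZero L], 2 ≤ L → ∀ ψ : TensorIndex (TorusSite 3 L) 2 → ℂ, ∑ x : TorusSite 3 L, ∑ y : TorusSite 3 L, (star ψ ⬝ᵥ ((1 : Op (TorusSite 3 L) 2) - permOp (Equiv.swap x y)) *ᵥ ψ).re ≤ C * (L : ℝ) ^ 5 * ∑ x : TorusSite 3 L, ∑ y : TorusSite 3 L, if (torusGraph 3 L).Adj x y then (star ψ ⬝ᵥ ((1 : Op (TorusSite 3 L) 2) - permOp (Equiv.swap x y)) *ᵥ ψ).re else 0 := by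
  refine ⟨144, by norm_num, ?_⟩
  intro L _ hL ψ
  have hS0 : ∀ a b : TorusSite 3 L, 0 ≤ ∑ σ : TensorIndex (TorusSite 3 L) 2,
      ‖ψ σ - ψ (fun x => σ (Equiv.swap a b x))‖ ^ 2 :=
    fun a b => Finset.sum_nonneg fun σ _ => sq_nonneg _
  have hsq : ∀ a b : TorusSite 3 L, √(∑ σ : TensorIndex (TorusSite 3 L) 2,
      ‖ψ σ - ψ (fun x => σ (Equiv.swap a b x))‖ ^ 2) ^ 2 =
      ∑ σ : TensorIndex (TorusSite 3 L) 2, ‖ψ σ - ψ (fun x => σ (Equiv.swap a b x))‖ ^ 2 :=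
    fun a b => Real.sq_sqrt (hS0 a b)
  have key := nidB2_sum_bound hL
    (fun a b => √(∑ σ : TensorIndex (TorusSite 3 L) 2, ‖ψ σ - ψ (fun x => σ (Equiv.swap a b x))‖ ^ 2))
    (fun a b => Real.sqrt_nonneg _) (fun a => nidB2_l2_swap_self ψ a)
    (fun a b c => nidB2_quasi_triangle ψ a b c) (fun a b c => nidB2_quasi_triangle' ψ a b c)
  simp only [hsq] at key
  simp only [nidB2_re_quad_eq]
  have hite : ∀ x y : TorusSite 3 L, (if (torusGraph 3 L).Adj x y then
      1 / 2 * ∑ σ : TensorIndex (TorusSite 3 L) 2, ‖ψ σ - ψ (fun z => σ (Equiv.swap x y z))‖ ^ 2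
      else 0) = 1 / 2 * (if (torusGraph 3 L).Adj x y then
      ∑ σ : TensorIndex (TorusSite 3 L) 2, ‖ψ σ - ψ (fun z => σ (Equiv.swap x y z))‖ ^ 2 else 0) := by
    intro x y; split_ifs <;> ring
  simp only [hite, ← Finset.mul_sum]
  linarith [key]

end Summit.AtomisticToContinuum.BoseEinsteinCondensation.Cruxes.NearIsotropicDiluteBEC.Birth

end
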